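/-
Copyright: formalisation for the LaceExpansionHighD cell (what-if lane, kernel instance at `d := 10`).
Source formalised: R. Fitzner, R. van der Hofstad, *Mean-field behavior for nearest-neighbor percolation in d > 10*
(the NoBLE analysis), §5.1.2 (5.16) p. 1092 and §5.3.3 p. 1098.
-/
import Literature.Probability.FitznerVanDerHofstad2017.SrwWPatternTablesD10A
import Literature.Probability.FitznerVanDerHofstad2017.SrwWPatternTablesD10B
import Literature.Probability.FitznerVanDerHofstad2017.SrwWPatternTablesD10C
import HarnessLib

/-!
# `W`-pattern far values — the combined table lookup and the bound-improving fold (`d := 10`, input certificate)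

A drop-in consumer interface for the three literal `W`-pattern tables (`SrwWPatternTablesD10{A,B,C}`):

* `wTabABC j p : Option ℚ` — the certified table value `≥ W_{1,j}(vecOfParts 10 p; 10)` if `(j, p)` is a row of
  one of the three tables (`srwW_le_of_wTabABC`), else `none`;
* `patFarStep κ p B j` — improve a far bound `B ≥ K_{1,κ}(vecOfParts 10 p)` by the free split `κ = (κ − j) + j`
  (`WPatD10.srwK_le_patFarQ`: Cauchy–Schwarz across the split, landed origin table at `κ − j ≤ 22`, Newton surrogate
  of the geometric mean) whenever the row `(j, p)` is certified (`srwK_le_patFarStep`);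
* `patFarMinQ B κ l` — the fold of `patFarStep` over `j < 12` at the class label `l` (parts list `WPatD10.partsOf l`,
  `canonSite 10 l = vecOfParts 10 (partsOf l)`), and **`srwK_canonSite_le_patFarMinQ`**: any valid far bound
  `K_{1,κ}(canonSite 10 l) ≤ B` improves to `K_{1,κ}(canonSite 10 l) ≤ patFarMinQ B κ l ≤ B`.

So a far-value table of the kernel-form cell may take `patFarMinQ (its own bound) κ l` as the certified value with a
one-line proof.  Pointer language only: an input certificate of the what-if lane, no statement about any dimension
other than the kernel parameter.
-/

set_option Elab.async false

namespace Literature.Probability.FitznerVanDerHofstad2017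

namespace WPatD10Far

open KTUD10 WPatD10 WPatD10TA WPatD10TB WPatD10TC

/-- The combined certified table value at row `(j, p)`, if any (tables A, B, C in this order; plumbing).
[folklore] -/
def wTabABC (j : ℕ) (p : List ℕ) : Option ℚ :=
  if (j, p) ∈ rowsA then some (wTabA j p)
  else if (j, p) ∈ rowsB then some (wTabB j p)
  else if (j, p) ∈ rowsC then some (wTabC j p)
  else none

/-- **`W_{1,j}(vecOfParts 10 p; 10) ≤ w`** whenever `wTabABC j p = some w` (input certificate: the orbit sum (5.16)
through the collision-pattern law and the monotone lookup over the landed shell-class tables).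
[cite: FitznerVanDerHofstad2016NoBLE, §5.1.2 (5.16) p. 1092] -/
theorem srwW_le_of_wTabABC {j : ℕ} {p : List ℕ} {w : ℚ} (h : wTabABC j p = some w) :
    srwW 10 1 j (vecOfParts 10 p) ≤ ((w : ℚ) : ℝ) := by
  unfold wTabABC at h
  split_ifs at h with hA hB hC
  · cases h; exact srwW_le_wTabA (j, p) hA
  · cases h; exact srwW_le_wTabB (j, p) hB
  · cases h; exact srwW_le_wTabC (j, p) hC

/-- One improvement step of a far bound `B` at total cut `κ` by the certified row `(j, p)` (if any, and if
`j ≤ κ`, `κ − j ≤ 22`): `min B (patFarQ (κ − j) w)`. [folklore] -/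
def patFarStep (κ : ℕ) (p : List ℕ) (B : ℚ) (j : ℕ) : ℚ :=
  if j ≤ κ ∧ κ - j ≤ 22 then (wTabABC j p).elim B fun w => min B (patFarQ (κ - j) w) else B

/-- **Soundness of one step**: `K_{1,κ}(vecOfParts 10 p) ≤ B ⟹ K_{1,κ}(vecOfParts 10 p) ≤ patFarStep κ p B j`.
[cite: FitznerVanDerHofstad2016NoBLE, §5.1.2 (5.16) p. 1092] -/
theorem srwK_le_patFarStep {κ : ℕ} {p : List ℕ} {B : ℚ}
    (hB : srwK 10 1 κ (vecOfParts 10 p) ≤ ((B : ℚ) : ℝ)) (j : ℕ) :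
    srwK 10 1 κ (vecOfParts 10 p) ≤ ((patFarStep κ p B j : ℚ) : ℝ) := by
  unfold patFarStep
  split_ifs with hj
  · cases hw : wTabABC j p with
    | none => simpa only [Option.elim_none] using hB
    | some w =>
      simp only [Option.elim_some, Rat.cast_min]
      refine le_min hB ?_
      have h := srwK_le_patFarQ hj.2 (srwW_le_of_wTabABC hw)
      rwa [Nat.sub_add_cancel hj.1] at h
  · exact hB

/-- `patFarStep κ p B j ≤ B` (the step never worsens the bound). [cite: FitznerVanDerHofstad2016NoBLE, §5.1.2 (5.16) p. 1092] -/
theorem patFarStep_le (κ : ℕ) (p : List ℕ) (B : ℚ) (j : ℕ) : patFarStep κ p B j ≤ B := by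
  unfold patFarStep
  split_ifs with hj
  · cases wTabABC j p with
    | none => exact le_rfl
    | some w => exact min_le_left _ _
  · exact le_rfl

/-- **The pattern far value of a class label**: the fold of `patFarStep` over the cuts `j < 12` at the parts list
`partsOf l`, started from a given far bound `B`. [folklore] -/
def patFarMinQ (B : ℚ) (κ : ℕ) (l : List ℕ) : ℚ := (List.range 12).foldl (patFarStep κ (partsOf l)) B

/-- Soundness of the fold (induction on the cut list). [folklore] -/
private theorem foldl_patFarStep_sound {κ : ℕ} {p : List ℕ} (js : List ℕ) {B : ℚ}
    (hB : srwK 10 1 κ (vecOfParts 10 p) ≤ ((B : ℚ) : ℝ)) :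
    srwK 10 1 κ (vecOfParts 10 p) ≤ ((js.foldl (patFarStep κ p) B : ℚ) : ℝ) := by
  induction js generalizing B with
  | nil => simpa only [List.foldl_nil] using hB
  | cons j js ih => rw [List.foldl_cons]; exact ih (srwK_le_patFarStep hB j)

/-- The fold never worsens the bound. [folklore] -/
private theorem foldl_patFarStep_le {κ : ℕ} {p : List ℕ} (js : List ℕ) (B : ℚ) :
    js.foldl (patFarStep κ p) B ≤ B := by
  induction js generalizing B with
  | nil => simp only [List.foldl_nil, le_refl]
  | cons j js ih => rw [List.foldl_cons]; exact (ih _).trans (patFarStep_le κ p B j)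

/-- **`K_{1,κ}(canonSite 10 l; 10) ≤ patFarMinQ B κ l`** from any valid far bound `K_{1,κ}(canonSite 10 l) ≤ B`
(input certificate: free splits `κ = (κ − j) + j` through the certified `W`-pattern rows of `partsOf l`).
[cite: FitznerVanDerHofstad2016NoBLE, §5.1.2 (5.16) p. 1092; §5.3.3 p. 1098] -/
theorem srwK_canonSite_le_patFarMinQ {κ : ℕ} {l : List ℕ} {B : ℚ}
    (hB : srwK 10 1 κ (canonSite 10 l) ≤ ((B : ℚ) : ℝ)) :
    srwK 10 1 κ (canonSite 10 l) ≤ ((patFarMinQ B κ l : ℚ) : ℝ) := by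
  rw [canonSite_eq_vecOfParts] at hB ⊢
  exact foldl_patFarStep_sound _ hB

/-- `patFarMinQ B κ l ≤ B`. [cite: FitznerVanDerHofstad2016NoBLE, §5.1.2 (5.16) p. 1092] -/
theorem patFarMinQ_le (B : ℚ) (κ : ℕ) (l : List ℕ) : patFarMinQ B κ l ≤ B := foldl_patFarStep_le _ B

end WPatD10Far

end Literature.Probability.FitznerVanDerHofstad2017
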